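import Mathlib
import Summits.MatrixMultiplication.MatrixMultiplication.Theorems.ThinPackings.Negative.TriageRuledGraphPatternedArc

set_option linter.dupNamespace false

/-!
# Stub `stub_deborderingPower` — de-bordering, finite core (`DeborderingPower`)

Crux `stmt-MatrixMultiplication-10595` (`Theses.ThinBlockAlpha.ThinPackings`), line
`label-weighted-stpp-debordering`.

For a label-weighted STPP family (`IsLabelWeightedSTPP A B C κ μ`) of `L` blocks `⟨N, M, N⟩` in an
abelian group `H`, with potentials `κ, μ` valued in `[-R, R]`, and every `n`: among the `Lⁿ` label
words `w : Fin n → Fin L`, the class map `w ↦ (Σₜ κ (w t), Σₜ μ (w t))` takes at most `(2nR+1)²`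
values, so a most popular class `W` has `Lⁿ ≤ |W| · (2nR+1)²` words; and the product blocks
`A_w = ∏ₜ A (w t)`, `B_w = ∏ₜ B (w t)`, `C_w = ∏ₜ C (w t)` (`w ∈ W`) form a genuine `IsSTPP` family
in `Fin n → H` (the STPP mirror image of Blasiak–Church–Cohn–Grochow–Naslund–Sawin–Umans 2017,
Lemma 3.4): a relation among three words of one class holds coordinatewise; a coordinate whose
three labels agree has weight `0`, any other coordinate has weight `≥ 1` by clause (5) of
`IsLabelWeightedSTPP`; the total weight telescopes to `0` inside a class, so every coordinate is
diagonal, the three words coincide, and clause (4) (TPP of each block) finishes coordinatewise.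

Main result: `stub_deborderingPower`.  Helper: `isSTPP_piFinset_of_weightClass` (the product family
indexed by an injection into a set of words with constant weight sums is `IsSTPP`).
-/

namespace Summit.MatrixMultiplication.MatrixMultiplication.Theorems.ThinPackings

open Finset
open Literature.Computability.AlgebraicComplexity (IsSTPP)
open Summit.MatrixMultiplication.MatrixMultiplication.Theorems.ThinPackings.Negative.Triage2 (IsLabelWeightedSTPP)

/-- **Product blocks of one weight class are STPP.**  If `w : Fin L' → (Fin n → Fin L)` is an
injective family of label words on which both weight sums `Σₜ κ (w x t)` and `Σₜ μ (w x t)` are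
constant, then the product blocks `(∏ₜ A (w x t), ∏ₜ B (w x t), ∏ₜ C (w x t))_{x}` of a
label-weighted STPP family form an `IsSTPP` family in `Fin n → H`. [new, elementary] -/
theorem isSTPP_piFinset_of_weightClass {H : Type*} [AddCommGroup H] {L n L' : ℕ}
    {A B C : Fin L → Finset H} {κ μ : Fin L → ℤ} (hW : IsLabelWeightedSTPP A B C κ μ)
    (w : Fin L' → (Fin n → Fin L)) (hw : Function.Injective w)
    (hκ : ∀ x y : Fin L', ∑ t, κ (w x t) = ∑ t, κ (w y t))
    (hμ : ∀ x y : Fin L', ∑ t, μ (w x t) = ∑ t, μ (w y t)) :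
    IsSTPP (fun x => Fintype.piFinset fun t => A (w x t))
      (fun x => Fintype.piFinset fun t => B (w x t))
      (fun x => Fintype.piFinset fun t => C (w x t)) := by
  obtain ⟨-, -, -, hT, hX⟩ := hW
  intro x y z s hs s' hs' t ht t' ht' u hu u' hu' hrel
  simp only [Fintype.mem_piFinset] at hs hs' ht ht' hu hu'
  have hrel' : ∀ l, (s' l - s l) + (t' l - t l) + (u' l - u l) = 0 := fun l => by
    simpa using congr_fun hrel l
  -- the weight of coordinate `l`
  have hclaim : ∀ l, 0 ≤ (κ (w x l) - κ (w z l)) + (μ (w y l) - μ (w z l)) ∧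
      ((κ (w x l) - κ (w z l)) + (μ (w y l) - μ (w z l)) = 0 → w x l = w y l ∧ w y l = w z l) := by
    intro l
    by_cases hdiag : w x l = w y l ∧ w y l = w z l
    · refine ⟨?_, fun _ => hdiag⟩
      rw [hdiag.1, hdiag.2, sub_self, sub_self, add_zero]
    · have h1 : 1 ≤ (κ (w x l) - κ (w z l)) + (μ (w y l) - μ (w z l)) :=
        hX (w x l) (w y l) (w z l) hdiag (s l) (hs l) (s' l) (hs' l) (t l) (ht l) (t' l) (ht' l)
          (u l) (hu l) (u' l) (hu' l) (hrel' l)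
      exact ⟨by omega, fun h0 => by omega⟩
  -- the total weight vanishes inside a class
  have hsum : ∑ l, ((κ (w x l) - κ (w z l)) + (μ (w y l) - μ (w z l))) = 0 := by
    rw [Finset.sum_add_distrib, Finset.sum_sub_distrib, Finset.sum_sub_distrib, hκ x z, hμ y z,
      sub_self, sub_self, add_zero]
  have hall : ∀ l, w x l = w y l ∧ w y l = w z l := by
    have h0 := (Finset.sum_eq_zero_iff_of_nonneg (fun l _ => (hclaim l).1)).1 hsum
    exact fun l => (hclaim l).2 (h0 l (Finset.mem_univ l))
  have hxy : x = y := hw (funext fun l => (hall l).1)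
  have hyz : y = z := hw (funext fun l => (hall l).2)
  subst hxy
  subst hyz
  have hcoord : ∀ l, s l = s' l ∧ t l = t' l ∧ u l = u' l := fun l =>
    hT (w x l) (s l) (hs l) (s' l) (hs' l) (t l) (ht l) (t' l) (ht' l) (u l) (hu l) (u' l) (hu' l)
      (hrel' l)
  exact ⟨rfl, rfl, funext fun l => (hcoord l).1, funext fun l => (hcoord l).2.1,
    funext fun l => (hcoord l).2.2⟩

/-- A sum of `n` potentials bounded by `R` in absolute value is bounded by `n R`. -/
theorem abs_sum_label_le {L n : ℕ} {R : ℕ} (f : Fin L → ℤ) (hf : ∀ i, |f i| ≤ R)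
    (w : Fin n → Fin L) : |∑ t, f (w t)| ≤ (n : ℤ) * R :=
  calc |∑ t, f (w t)| ≤ ∑ t, |f (w t)| := Finset.abs_sum_le_sum_abs _ _
    _ ≤ ∑ _t : Fin n, (R : ℤ) := Finset.sum_le_sum fun t _ => hf (w t)
    _ = (n : ℤ) * R := by simp

/-- The box `[-nR, nR]²` of possible weight classes has `(2nR+1)²` elements. -/
theorem card_weightBox (n R : ℕ) :
    (Icc (-((n : ℤ) * R)) ((n : ℤ) * R) ×ˢ Icc (-((n : ℤ) * R)) ((n : ℤ) * R)).card =
      (2 * n * R + 1) ^ 2 := by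
  have h : ((n : ℤ) * R + 1 - -((n : ℤ) * R)).toNat = 2 * n * R + 1 := by
    have : ((n : ℤ) * R + 1 - -((n : ℤ) * R)) = ((2 * n * R + 1 : ℕ) : ℤ) := by
      push_cast; ring
    rw [this, Int.toNat_natCast]
  rw [Finset.card_product, Int.card_Icc, h, sq]

/-- **Popular class.**  If `f` maps `s` into a nonempty `t`, some fibre of `f` over `t` has at
least `|s| / |t|` elements: `|s| ≤ |t| · |fibre|`. -/
theorem exists_popular_fiber {α β : Type*} [DecidableEq β] (s : Finset α) (t : Finset β)
    (f : α → β) (hf : ∀ a ∈ s, f a ∈ t) (ht : t.Nonempty) :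
    ∃ c ∈ t, s.card ≤ t.card * (s.filter fun a => f a = c).card := by
  obtain ⟨c, hct, hcmax⟩ := Finset.exists_max_image t (fun c => (s.filter fun a => f a = c).card) ht
  refine ⟨c, hct, ?_⟩
  calc s.card = ∑ b ∈ t, (s.filter fun a => f a = b).card := Finset.card_eq_sum_card_fiberwise hf
    _ ≤ ∑ _b ∈ t, (s.filter fun a => f a = c).card := Finset.sum_le_sum fun b hb => hcmax b hb
    _ = t.card * (s.filter fun a => f a = c).card := by rw [Finset.sum_const, smul_eq_mul]

/-- **stub_deborderingPower** — de-bordering, finite core (`= DeborderingPower`): a label-weighted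
STPP family of `L` blocks `⟨N, M, N⟩` with potentials in `[-R, R]` yields, for every `n`, a genuine
`IsSTPP` family of `L' ≥ Lⁿ / (2nR+1)²` blocks `⟨Nⁿ, Mⁿ, Nⁿ⟩` in `Fin n → H` (the product blocks
of a most popular weight class of label words).  The STPP mirror image of
Blasiak–Church–Cohn–Grochow–Naslund–Sawin–Umans 2017, Lemma 3.4. [new, elementary] -/
theorem stub_deborderingPower :
    ∀ (H : Type) [AddCommGroup H] (L N M R : ℕ) (A B C : Fin L → Finset H) (κ μ : Fin L → ℤ),
      IsLabelWeightedSTPP A B C κ μ → (∀ i, (A i).card = N ∧ (B i).card = M ∧ (C i).card = N) →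
      (∀ i, |κ i| ≤ R ∧ |μ i| ≤ R) →
      ∀ n : ℕ, ∃ (L' : ℕ) (A' B' C' : Fin L' → Finset (Fin n → H)),
        IsSTPP A' B' C' ∧ (∀ i, (A' i).card = N ^ n ∧ (B' i).card = M ^ n ∧ (C' i).card = N ^ n) ∧
        L ^ n ≤ L' * (2 * n * R + 1) ^ 2 := by
  intro H _ L N M R A B C κ μ hW hcard hR n
  classical
  -- the class map and the box of classes
  let cls : (Fin n → Fin L) → ℤ × ℤ := fun w => (∑ t, κ (w t), ∑ t, μ (w t))
  let S : Finset (ℤ × ℤ) :=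
    Icc (-((n : ℤ) * R)) ((n : ℤ) * R) ×ˢ Icc (-((n : ℤ) * R)) ((n : ℤ) * R)
  have hmaps : ∀ w ∈ (univ : Finset (Fin n → Fin L)), cls w ∈ S := by
    intro w _
    have h1 := abs_sum_label_le κ (fun i => (hR i).1) w
    have h2 := abs_sum_label_le μ (fun i => (hR i).2) w
    rw [abs_le] at h1 h2
    simp only [cls, S, Finset.mem_product, Finset.mem_Icc]
    exact ⟨⟨h1.1, h1.2⟩, h2.1, h2.2⟩
  have hSne : S.Nonempty := by
    refine ⟨(0, 0), ?_⟩
    have h0 : (0 : ℤ) ≤ (n : ℤ) * R := by positivity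
    simp only [S, Finset.mem_product, Finset.mem_Icc]
    exact ⟨⟨by linarith, h0⟩, by linarith, h0⟩
  obtain ⟨c, _, hc⟩ := exists_popular_fiber univ S cls hmaps hSne
  -- the popular class `W` and its enumeration
  set W : Finset (Fin n → Fin L) := univ.filter fun w => cls w = c with hWdef
  let e : Fin W.card → (Fin n → Fin L) := fun x => ((W.equivFin.symm x : W) : Fin n → Fin L)
  have he : Function.Injective e := Subtype.val_injective.comp W.equivFin.symm.injective
  have hecls : ∀ x, cls (e x) = c := fun x => (Finset.mem_filter.1 (W.equivFin.symm x).2).2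
  have hκ : ∀ x y : Fin W.card, ∑ t, κ (e x t) = ∑ t, κ (e y t) := fun x y => by
    have hx := congrArg Prod.fst (hecls x)
    have hy := congrArg Prod.fst (hecls y)
    simp only [cls] at hx hy
    rw [hx, hy]
  have hμ : ∀ x y : Fin W.card, ∑ t, μ (e x t) = ∑ t, μ (e y t) := fun x y => by
    have hx := congrArg Prod.snd (hecls x)
    have hy := congrArg Prod.snd (hecls y)
    simp only [cls] at hx hy
    rw [hx, hy]
  refine ⟨W.card, fun x => Fintype.piFinset fun t => A (e x t),
    fun x => Fintype.piFinset fun t => B (e x t), fun x => Fintype.piFinset fun t => C (e x t),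
    isSTPP_piFinset_of_weightClass hW e he hκ hμ, ?_, ?_⟩
  · intro x
    simp [Fintype.card_piFinset, hcard]
  · have hLn : L ^ n = (univ : Finset (Fin n → Fin L)).card := by
      rw [Finset.card_univ, Fintype.card_fun, Fintype.card_fin, Fintype.card_fin]
    rw [hLn, mul_comm, ← card_weightBox n R]
    exact hc

end Summit.MatrixMultiplication.MatrixMultiplication.Theorems.ThinPackings
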